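import Mathlib
import Summits.Ventures.PercRepro2.OneSidedBase
import Summits.Ventures.PercRepro2.LocRows
import Summits.Ventures.PercRepro2.SwRow

/-!
# The Reimer-covered part of row (SW) / 2′DOM, and the exact residual
(blind cell PercRepro2, night-4 g3, 2026-08-24T08:5xZ; proofs/NIGHT4-SW.md §3)

Row 2′DOM on the free fibre at the principal up-set reads, for every up-set `𝓥` of vertex sets
(`SwRow.lean`, `sw_iff_card_le`): `#{ζ ∈ Q : C_R(h) ∈ 𝓥} ≤ #{ζ ∈ Q : C_B(h) ∈ 𝓥}` on
`Q = tgtU ends l h {S ∣ o ∈ S} = {h ∉ H_l, o ∈ R_side(l)}`.  Reimer's inequality restricted to a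
decreasing event (mine-1's `ReimerCube.reimer_decreasing`) proves it for the part of the left side in
which the red cluster of `h` reaches its `𝓥`-witness WITHOUT using the blue cluster of `l`:

* `offBlue ends l ζ` — the configuration with every edge touching `C_B(l)(ζ)` deleted
  (`delConfig`); `cluster ends (offBlue ends l ζ) h` is the red cluster of `h` avoiding `C_B(l)`;
* `card_offBlue_le` (Finset form `count_le_offBlue`):
  `#{ζ ∈ Q : C_R(h)(offBlue ζ) ∈ 𝓥} ≤ #{ζ ∈ Q : C_B(h) ∈ 𝓥}`.
  Witnesses: `A = {o ∈ R_side, h ∉ C_B(l)}` (increasing) is witnessed by the red `l`-component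
  together with the red edges touching `C_B(l)` (every blue path from `l` stays inside `C_B(l)`
  once those are fixed red), `J = {C_R(h) ∈ 𝓥}` (increasing) by the red `h`-component of the
  edges off `C_B(l)`; the two witnesses are disjoint (`h ∉ C_R(l)`, `D` decreasing); the target of
  Reimer's inequality is `A ∩ J̄ ∩ D = Q ∩ {C_B(h) ∈ 𝓥}` exactly.
* `card_offBlue_le_point`: the `b`-principal case `𝓥 = {S ∣ b ∈ S}` — the part of (BASE)
  `#{Q, b ∈ C_R(h)} ≤ #{Q, b ∈ C_B(h)}` in which `b` is red-connected to `h` avoiding `C_B(l)`.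

What is NOT covered — the exact residual of the row — are the configurations of `Q` whose red
`h`-cluster needs vertices of `C_B(l)` (hence of its blue side) to lie in `𝓥`: no choice of
up-witnesses makes them a disjoint occurrence (the cut around `C_B(l)` is crossed by every such red
path), so the remaining content of the weight-free base is the transport of those configurations,
which any injection must realise by moving the blue cluster of `l` (census: into `C_R(l)`).
-/

namespace Summit.Ventures.PercRepro2

namespace ReimerPart

open ReimerCube OneSided Hull Finset

variable {V : Type*} {E : Type*} [Fintype E] [DecidableEq E]

open scoped Classical

variable (ends : E → Sym2 V)

/-! ## The red set off the blue cluster of `l` -/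

/-- The configuration with every edge touching the blue cluster of `l` deleted. -/
noncomputable def offBlue (l : V) (ζ : Config E) : Config E :=
  delConfig ends (cluster ends (blue ζ) l) ζ

/-- The edges of a red set `S` that do not touch the blue cluster of `l` (Finset form). -/
noncomputable def offBlueSet (l : V) (S : Finset E) : Finset E :=
  S.filter fun e => e ∉ touches ends (cluster ends (blue (ofFinset S)) l)

omit [Fintype E] in
/-- `offBlueSet` is a subset of the red set. -/
lemma offBlueSet_subset (l : V) (S : Finset E) : offBlueSet ends l S ⊆ S :=
  Finset.filter_subset _ _

omit [Fintype E] in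
/-- The two forms agree: `ofFinset (offBlueSet S) = offBlue (ofFinset S)`. -/
lemma ofFinset_offBlueSet (l : V) (S : Finset E) :
    ofFinset (offBlueSet ends l S) = offBlue ends l (ofFinset S) := by
  funext e
  by_cases he : e ∈ touches ends (cluster ends (blue (ofFinset S)) l)
  · rw [offBlue, delConfig_apply_of_mem he]
    simp [ofFinset_apply, offBlueSet, he]
  · rw [offBlue, delConfig_apply_of_notMem he]
    simp [ofFinset_apply, offBlueSet, he]

/-! ## The events on the cube -/

/-- `A`: `o ∈ R_side(l)` and `h ∉ C_B(l)` — increasing in the red set. -/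
def evA (l h o : V) (S : Finset E) : Prop :=
  Carries ends S l o ∧ ¬ Carries ends (Finset.univ \ S) l o ∧ ¬ Carries ends (Finset.univ \ S) l h

/-- `D`: `h ∉ C_R(l)` — decreasing in the red set. -/
def evD (l h : V) (S : Finset E) : Prop := ¬ Carries ends S l h

/-- `J`: the red cluster of `h` lies in `𝓥` — increasing for an up-set `𝓥`. -/
def evJ (h : V) (𝓥 : Set (Set V)) (S : Finset E) : Prop :=
  cluster ends (ofFinset S) h ∈ 𝓥

/-- `A` is increasing. -/
lemma incr_evA (l h o : V) : Incr (evA ends l h o) := by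
  intro S T hST hS
  refine ⟨hS.1.mono hST, fun h' => hS.2.1 (h'.mono (Finset.sdiff_subset_sdiff le_rfl hST)),
    fun h' => hS.2.2 (h'.mono (Finset.sdiff_subset_sdiff le_rfl hST))⟩

omit [Fintype E] in
/-- `D` is decreasing. -/
lemma decr_evD (l h : V) : Decr (evD ends l h) :=
  fun _ _ hST hT hS => hT (hS.mono hST)

omit [Fintype E] in
/-- `J` is increasing for an up-set `𝓥`. -/
lemma incr_evJ (h : V) {𝓥 : Set (Set V)} (h𝓥 : IsUpperSet 𝓥) : Incr (evJ ends h 𝓥) := by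
  intro S T hST hS
  exact h𝓥 (cluster_mono (ofFinset_mono hST) h) hS

omit [Fintype E] in
/-- The blue cluster of `l` in `T` lies inside the blue cluster of `l` in `S` whenever `T` contains
every red edge of `S` touching that blue cluster. -/
lemma cluster_blue_subset_of_supset {l : V} {S T : Finset E}
    (hK : S.filter (fun e => e ∈ touches ends (cluster ends (blue (ofFinset S)) l)) ⊆ T) :
    cluster ends (blue (ofFinset T)) l ⊆ cluster ends (blue (ofFinset S)) l := by
  intro u hu
  rw [mem_cluster] at hu
  refine mem_of_conn_of_closed (ends := ends) (ω := blue (ofFinset T))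
    (S := cluster ends (blue (ofFinset S)) l) ?_ (mem_cluster_self _ _ _) hu
  intro x hx y hxy
  rw [openGraph_adj] at hxy
  obtain ⟨_, e, he, hends⟩ := hxy
  by_contra hy
  -- `e` leaves the blue cluster of `l` in `S`, so it is red in `S` and touches the cluster
  have heS : e ∈ S := by
    by_contra heS
    have hb : blue (ofFinset S) e = true := by
      rw [blue_apply, ofFinset_apply]; simpa using heS
    exact hy (mem_cluster_of_edge hx hb hends)
  have het : e ∈ touches ends (cluster ends (blue (ofFinset S)) l) := ⟨x, hx, y, hends⟩
  have heT : e ∈ T := hK (Finset.mem_filter.2 ⟨heS, het⟩)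
  -- but `e` is blue in `T`
  rw [blue_apply, ofFinset_apply] at he
  simp [heT] at he

/-- **Reimer's inequality covers the off-blue part** (Finset form): for every up-set `𝓥`,
`#{A, C_R(h)(off C_B(l)) ∈ 𝓥, D} ≤ #{A, C_B(h) ∈ 𝓥, D}`. -/
theorem count_le_offBlue (l h o : V) {𝓥 : Set (Set V)} (h𝓥 : IsUpperSet 𝓥) :
    (Finset.univ.powerset.filter fun S : Finset E =>
        evA ends l h o S ∧ cluster ends (ofFinset (offBlueSet ends l S)) h ∈ 𝓥 ∧ evD ends l h S).card ≤
      (Finset.univ.powerset.filter fun S : Finset E =>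
        evA ends l h o S ∧ cluster ends (blue (ofFinset S)) h ∈ 𝓥 ∧ evD ends l h S).card := by
  calc (Finset.univ.powerset.filter fun S : Finset E =>
        evA ends l h o S ∧ cluster ends (ofFinset (offBlueSet ends l S)) h ∈ 𝓥 ∧ evD ends l h S).card
      ≤ (Finset.univ.powerset.filter fun S : Finset E =>
          DOcc (evA ends l h o) (evJ ends h 𝓥) S ∧ evD ends l h S).card := by
        apply Finset.card_le_card
        intro S hS
        simp only [Finset.mem_filter, Finset.mem_powerset] at hS ⊢
        obtain ⟨hSU, hAS, hJS, hDS⟩ := hS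
        refine ⟨hSU, ?_, hDS⟩
        -- the witnesses
        set K : Finset E := sComp ends S l ∪
          S.filter (fun e => e ∈ touches ends (cluster ends (blue (ofFinset S)) l)) with hKdef
        set L : Finset E := sComp ends (offBlueSet ends l S) h with hLdef
        refine ⟨K, L, ?_, ?_, ?_, ?_, ?_⟩
        · -- `K ⊆ S`
          exact Finset.union_subset (sComp_subset ends S l) (Finset.filter_subset _ _)
        · -- `L ⊆ S`
          exact (sComp_subset ends _ h).trans (offBlueSet_subset ends l S)
        · -- disjoint
          rw [Finset.disjoint_left]
          intro e heK heL
          have heOff : e ∈ offBlueSet ends l S := sComp_subset ends _ h heL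
          rw [offBlueSet, Finset.mem_filter] at heOff
          rw [hKdef, Finset.mem_union] at heK
          rcases heK with heK | heK
          · -- `e` in the red `l`-component: an endpoint is reachable from `l`, and from `h`
            rw [sComp, Finset.mem_filter] at heK
            obtain ⟨_, x, hx, hlx⟩ := heK
            have hhx : Carries ends (offBlueSet ends l S) h x := carries_of_mem_sComp heL hx
            have hhx' : Carries ends S h x := hhx.mono (offBlueSet_subset ends l S)
            exact hDS (conn_trans hlx (conn_symm hhx'))
          · rw [Finset.mem_filter] at heK
            exact heOff.2 heK.2
        · -- `K` is an up-witness of `A`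
          intro T hT
          have hKT : S.filter (fun e => e ∈ touches ends (cluster ends (blue (ofFinset S)) l)) ⊆ T :=
            Finset.subset_union_right.trans hT
          have hsub := cluster_blue_subset_of_supset ends (l := l) hKT
          refine ⟨?_, ?_, ?_⟩
          · exact (carries_sComp hAS.1).mono (Finset.subset_union_left.trans hT)
          · intro hc
            apply hAS.2.1
            have : o ∈ cluster ends (blue (ofFinset T)) l := by
              rw [mem_cluster, ← ofFinset_sdiff]; exact hc
            have ho := hsub this
            rw [mem_cluster, ← ofFinset_sdiff] at ho
            exact ho
          · intro hc
            apply hAS.2.2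
            have : h ∈ cluster ends (blue (ofFinset T)) l := by
              rw [mem_cluster, ← ofFinset_sdiff]; exact hc
            have hh := hsub this
            rw [mem_cluster, ← ofFinset_sdiff] at hh
            exact hh
        · -- `L` is an up-witness of `J`
          intro T hT
          refine h𝓥 ?_ hJS
          intro x hx
          rw [mem_cluster] at hx ⊢
          exact (carries_sComp (K := offBlueSet ends l S) hx).mono hT
    _ ≤ (Finset.univ.powerset.filter fun S : Finset E =>
          evA ends l h o S ∧ evJ ends h 𝓥 (Finset.univ \ S) ∧ evD ends l h S).card :=
        reimer_decreasing Finset.univ (evA ends l h o) (evJ ends h 𝓥) (evD ends l h)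
          (incr_evA ends l h o) (incr_evJ ends h h𝓥) (decr_evD ends l h)
    _ = _ := by
        congr 1; ext S
        simp only [Finset.mem_filter, evJ, ofFinset_sdiff]

/-! ## The configuration-level statement -/

/-- Membership in `Q = tgtU ends l h {S ∣ o ∈ S}` in the cube vocabulary. -/
lemma mem_tgtU_iff_evA_evD (l h o : V) (S : Finset E) :
    ofFinset S ∈ LocRows.tgtU ends l h {S : Set V | o ∈ S} ↔ evA ends l h o S ∧ evD ends l h S := by
  simp only [LocRows.tgtU, Finset.mem_filter, Finset.mem_univ, true_and, Set.mem_setOf_eq,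
    mem_hull_iff, mem_cluster, evA, evD, Carries, ofFinset_sdiff]
  tauto

/-- **The Reimer-covered part of row (SW) / 2′DOM**: for every up-set `𝓥`,
`#{ζ ∈ Q : C_R(h)(off C_B(l)) ∈ 𝓥} ≤ #{ζ ∈ Q : C_B(h) ∈ 𝓥}`. -/
theorem card_offBlue_le (l h o : V) {𝓥 : Set (Set V)} (h𝓥 : IsUpperSet 𝓥) :
    ((LocRows.tgtU ends l h {S : Set V | o ∈ S}).filter fun ζ =>
        cluster ends (offBlue ends l ζ) h ∈ 𝓥).card ≤
      ((LocRows.tgtU ends l h {S : Set V | o ∈ S}).filter fun ζ =>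
        cluster ends (blue ζ) h ∈ 𝓥).card := by
  have e1 : ((LocRows.tgtU ends l h {S : Set V | o ∈ S}).filter fun ζ =>
        cluster ends (offBlue ends l ζ) h ∈ 𝓥) =
      Finset.univ.filter fun ζ : Config E =>
        ζ ∈ LocRows.tgtU ends l h {S : Set V | o ∈ S} ∧ cluster ends (offBlue ends l ζ) h ∈ 𝓥 := by
    ext ζ; simp
  have e2 : ((LocRows.tgtU ends l h {S : Set V | o ∈ S}).filter fun ζ =>
        cluster ends (blue ζ) h ∈ 𝓥) =
      Finset.univ.filter fun ζ : Config E =>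
        ζ ∈ LocRows.tgtU ends l h {S : Set V | o ∈ S} ∧ cluster ends (blue ζ) h ∈ 𝓥 := by
    ext ζ; simp
  rw [e1, e2, card_filter_eq_card_powerset_filter, card_filter_eq_card_powerset_filter]
  have key := count_le_offBlue ends l h o h𝓥
  refine le_of_le_of_eq (le_of_eq_of_le ?_ key) ?_
  · congr 1; ext S
    simp only [Finset.mem_filter, Finset.mem_powerset, mem_tgtU_iff_evA_evD, ofFinset_offBlueSet]
    tauto
  · congr 1; ext S
    simp only [Finset.mem_filter, Finset.mem_powerset, mem_tgtU_iff_evA_evD]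
    tauto

/-- The `b`-principal case: the part of (BASE) in which `b` is red-connected to `h` avoiding the
blue cluster of `l`. -/
theorem card_offBlue_le_point (l h o b : V) :
    ((LocRows.tgtU ends l h {S : Set V | o ∈ S}).filter fun ζ =>
        b ∈ cluster ends (offBlue ends l ζ) h).card ≤
      ((LocRows.tgtU ends l h {S : Set V | o ∈ S}).filter fun ζ =>
        b ∈ cluster ends (blue ζ) h).card :=
  card_offBlue_le ends l h o (𝓥 := {S : Set V | b ∈ S}) (fun _ _ hST hb => hST hb)

end ReimerPart

end Summit.Ventures.PercRepro2
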